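import Literature.NumberTheory.Automorphic.PlaneLatticesCompanionStable           -- ★ p841196 (β1) (+ ★ (L5-a) Hermite currency, ★ `mem_glInt_of_isIntegralMatrix`)
import HarnessLib

/-!
# Self-duality of a plane lattice in Hermite form for an ANTIDIAGONAL hermitian Gram matrix `!![0, β; σβ, 0]` (the isotropic cyclic frame of a type-(2) element)
# (Flicker 1998, §6 p. 97; Jacobowitz 1962 §7)

Topic `NumberTheory/Automorphic`; namespace `Literature.NumberTheory.Automorphic`.  THEOREMS ONLY (no definition, no instance, no notation, no named fact,
no `sorry`).  Cell `pub/hodgecm-mathlib`, F0∕P3a road «D-N7-inert» ∕ MAP v3 (F11-d): brick **(β3′)** of the TYPE-(2) H-side value (B-p10 (g24) plan 05:01Z: in the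
isotropic cyclic frame `P = (e₀ | γ e₀)` of an elliptic `γ ∈ U(Φ₂)_v` of type (2) the Gram matrix is `!![0, β; σβ, 0]`, `β = γ₁₀`).  HC_CM is proved only modulo the
printed citations until rung 0 closes; this file is unconditional and elementary.

THE COMPUTATION.  For `T = T(k, y, l) = !![ϖ^k, y; 0, ϖ^l]` (`σ ϖ = ϖ`):
`ᵗ(σT) · !![0, β; σβ, 0] · T = !![0, β ϖ^{k+l}; σβ ϖ^{k+l}, ϖ^l (β σy + σβ y)]`,
of determinant `−(βϖ^{k+l}) σ(βϖ^{k+l})`.  So (`σ` isometric for the valuation) the lattice `Λ(T)` is SELF-DUAL — the Gram matrix lies in `GL₂(𝒪)`, the socket token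
`∃ J′ ∈ glInt 2 F, ↑J′ = formCongr σ g H` — iff `|β ϖ^{k+l}| = 1` and `ϖ^l · Tr(σβ · y) ∈ 𝒪`.

* §1 `formCongr_hermite_antidiag` — the Gram matrix.
* §2 **`exists_mem_glInt_coe_eq_formCongr_hermite_antidiag_iff`** — the criterion.

## References
* [Flicker1998UnitaryFL] Y. Z. Flicker, *Elementary proof of the fundamental lemma for a unitary group*, Canad. J. Math. 50 (1998), §6 p. 97.
* [Jacobowitz1962] R. Jacobowitz, *Hermitian forms over local fields*, Amer. J. Math. 84 (1962), §7.
-/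

set_option autoImplicit false

noncomputable section

open scoped ValuativeRel Matrix MatrixGroups
open Matrix ValuativeRel

namespace Literature.NumberTheory.Automorphic

variable {F : Type*} [Field F] [ValuativeRel F] (σ : F →+* F) {ϖ : F} (hϖ : IsUniformizingElement ϖ)

/-! ## §1 The Gram matrix of a Hermite lattice for an antidiagonal form -/

omit [ValuativeRel F] in
/-- `ᵗ(σ T) · !![0, β; σβ, 0] · T = !![0, β ϖ^{k+l}; σβ ϖ^{k+l}, ϖ^l (β σy + σβ y)]` for `T = !![ϖ^k, y; 0, ϖ^l]`, `σ ϖ = ϖ`. [cite: Jacobowitz1962, §7] -/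
theorem formCongr_hermite_antidiag (hϖ0 : ϖ ≠ 0) (hσϖ : σ ϖ = ϖ) {k l : ℤ} {y β : F} (g : GL (Fin 2) F)
    (hg : (g : Matrix (Fin 2) (Fin 2) F) = !![ϖ ^ k, y; 0, ϖ ^ l]) :
    formCongr σ g (!![0, β; σ β, 0] : Matrix (Fin 2) (Fin 2) F) =
      !![0, β * ϖ ^ (k + l); σ β * ϖ ^ (k + l), ϖ ^ l * (β * σ y + σ β * y)] := by
  have hσk : ∀ m : ℤ, σ (ϖ ^ m) = ϖ ^ m := fun m => by rw [map_zpow₀, hσϖ]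
  rw [formCongr, hg]
  have hmap : (!![ϖ ^ k, y; 0, ϖ ^ l] : Matrix (Fin 2) (Fin 2) F).map σ = !![ϖ ^ k, σ y; 0, ϖ ^ l] := by
    ext i j; fin_cases i <;> fin_cases j <;> simp [hσk]
  rw [hmap]
  have htr : (!![ϖ ^ k, σ y; 0, ϖ ^ l] : Matrix (Fin 2) (Fin 2) F)ᵀ = !![ϖ ^ k, 0; σ y, ϖ ^ l] := by
    ext i j; fin_cases i <;> fin_cases j <;> simp
  rw [htr]
  -- first product `H · T`
  have f11 : (0 : F) * ϖ ^ k + β * 0 = 0 := by ring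
  have f12 : (0 : F) * y + β * ϖ ^ l = β * ϖ ^ l := by ring
  have f21 : σ β * ϖ ^ k + 0 * 0 = σ β * ϖ ^ k := by ring
  have f22 : σ β * y + 0 * ϖ ^ l = σ β * y := by ring
  -- second product `ᵗ(σT) · (H T)`
  have e11 : ϖ ^ k * 0 + 0 * (σ β * ϖ ^ k) = (0 : F) := by ring
  have e12 : ϖ ^ k * (β * ϖ ^ l) + 0 * (σ β * y) = β * ϖ ^ (k + l) := by rw [zpow_add₀ hϖ0]; ring
  have e21 : σ y * 0 + ϖ ^ l * (σ β * ϖ ^ k) = σ β * ϖ ^ (k + l) := by rw [zpow_add₀ hϖ0]; ring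
  have e22 : σ y * (β * ϖ ^ l) + ϖ ^ l * (σ β * y) = ϖ ^ l * (β * σ y + σ β * y) := by ring
  rw [Matrix.mul_assoc, Matrix.mul_fin_two, f11, f12, f21, f22, Matrix.mul_fin_two, e11, e12, e21, e22]

/-! ## §2 The self-duality criterion -/

include hϖ in
/-- **SELF-DUALITY FOR AN ANTIDIAGONAL GRAM MATRIX IN HERMITE COORDINATES**: for `σ` fixing `ϖ` and preserving the valuation, `↑g = T(k, y, l)` and `H = !![0, β; σβ, 0]`,
`(∃ J′ ∈ GL₂(𝒪), ↑J′ = ᵗ(σg) H g) ↔ |β ϖ^{k+l}| = 1 ∧ ϖ^l (β σy + σβ y) ∈ 𝒪` (the Gram matrix `!![0, x; σx, ϖ^l Tr(σβ y)]`, `x = βϖ^{k+l}`, has determinant `−x σx`).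
[cite: Jacobowitz1962, §7] [cite: Flicker1998UnitaryFL, §6 p. 97] -/
theorem exists_mem_glInt_coe_eq_formCongr_hermite_antidiag_iff (hσϖ : σ ϖ = ϖ) (hσv : ∀ x, valuation F (σ x) = valuation F x)
    {k l : ℤ} {y β : F} (g : GL (Fin 2) F) (hg : (g : Matrix (Fin 2) (Fin 2) F) = !![ϖ ^ k, y; 0, ϖ ^ l]) :
    (∃ J' ∈ glInt 2 F, (J' : Matrix (Fin 2) (Fin 2) F) = formCongr σ g (!![0, β; σ β, 0] : Matrix (Fin 2) (Fin 2) F)) ↔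
      valuation F (β * ϖ ^ (k + l)) = 1 ∧ ϖ ^ l * (β * σ y + σ β * y) ∈ 𝒪[F] := by
  have h0 := hϖ.ne_zero
  have hG := formCongr_hermite_antidiag σ h0 hσϖ g hg (β := β)
  have hσx : σ (β * ϖ ^ (k + l)) = σ β * ϖ ^ (k + l) := by rw [map_mul, map_zpow₀, hσϖ]
  have hdet : (formCongr σ g (!![0, β; σ β, 0] : Matrix (Fin 2) (Fin 2) F)).det = -((β * ϖ ^ (k + l)) * σ (β * ϖ ^ (k + l))) := by
    rw [hG, Matrix.det_fin_two_of, hσx]; ring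
  -- `|x σx| = 1 ⟺ |x| = 1`
  have hxx : ∀ x : F, valuation F (x * σ x) = 1 ↔ valuation F x = 1 := fun x => by
    rw [map_mul, hσv]
    refine ⟨fun h => ?_, fun h => by rw [h, mul_one]⟩
    rcases lt_trichotomy (valuation F x) 1 with hlt | heq | hgt
    · exact absurd h (mul_lt_one' hlt hlt).ne
    · exact heq
    · exact absurd h (one_lt_mul'' hgt hgt).ne'
  constructor
  · rintro ⟨J', hJ', hJ'e⟩
    have hdet1 := valuation_det_eq_one_of_mem_glInt hJ'
    rw [hJ'e, hdet, Valuation.map_neg] at hdet1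
    refine ⟨(hxx _).1 hdet1, ?_⟩
    have h11 := ((mem_glInt_iff J').1 hJ').1 1 1
    rw [hJ'e, hG] at h11
    simpa using h11
  · rintro ⟨hx, htr⟩
    have hx1 : β * ϖ ^ (k + l) ∈ 𝒪[F] := (Valuation.mem_integer_iff _ _).2 hx.le
    have hσx1 : σ β * ϖ ^ (k + l) ∈ 𝒪[F] := (Valuation.mem_integer_iff _ _).2 (by rw [← hσx, hσv]; exact hx.le)
    have hdetv : valuation F (formCongr σ g (!![0, β; σ β, 0] : Matrix (Fin 2) (Fin 2) F)).det = 1 := by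
      rw [hdet, Valuation.map_neg]; exact (hxx _).2 hx
    have hdetU : IsUnit (formCongr σ g (!![0, β; σ β, 0] : Matrix (Fin 2) (Fin 2) F)).det :=
      isUnit_iff_ne_zero.2 fun h => by rw [h, map_zero] at hdetv; exact zero_ne_one hdetv
    refine ⟨Matrix.GeneralLinearGroup.mk'' _ hdetU, mem_glInt_of_isIntegralMatrix (fun i j => ?_) hdetv, rfl⟩
    show (formCongr σ g (!![0, β; σ β, 0] : Matrix (Fin 2) (Fin 2) F)) i j ∈ 𝒪[F]
    rw [hG]
    fin_cases i <;> fin_cases j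
    · simp
    · simpa using hx1
    · simpa using hσx1
    · simpa using htr

end Literature.NumberTheory.Automorphic

end
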